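import Summits.AnomalousDissipation.AnomalousDissipation.Theorems.HopfSnakePeriodicOrbitsEnstrophyBoundCore
import Literature.Analysis.FluidPDE.TorusClassicalH1Balance
import Literature.Analysis.FunctionSpaces.TorusEnstrophyTrilinear

/-!
# `HopfSnake.PeriodicOrbitsEnstrophyBound` (item stmt-AnomalousDissipation-1804) in the laminar regime

Sequel of `HopfSnakePeriodicOrbitsEnstrophyBoundCore.lean`. The item asks for a bound
`‖∇u(t)‖₂² ≤ C(ν, f, R)` uniform over all bounded-energy (`E ≤ R`) time-periodic classical
solutions of `NS_ν(f)` on `T³`; in general this is an open quantitative-regularity statement. Here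
we prove it — for ALL bounded-energy global classical solutions, periodic or not — in the LAMINAR
REGIME where the data size `(R + ‖f‖₂²)/ν` is small against `ν^{3/2}`: the enstrophy equation
(`Torus.IsClassicalNSSolutionOn.hasDerivWithinAt_half_gradNormSq`, FMRT 2001 (A.55)) with the
three-dimensional trilinear estimate (`Torus.abs_integral_inner_convect_laplacian_le_dissipation`,
FMRT (A.26b) + Young) gives the Riccati-type inequality `y' ≤ (16K⁴/ν³) y³ + ‖f‖₂²/ν` for
`y = ‖∇u‖₂²`; good instants `‖∇u(s)‖₂² ≤ (2R + ½‖f‖₂²)/ν` are `1`-dense (Core file); and a level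
`Y` above the good level which is a strict barrier over unit time
(`128K⁴Y³/ν³ + ‖f‖₂²/ν < Y`) fences `y ≤ 2Y` forever (Mathlib's fencing theorem
`image_le_of_deriv_right_lt_deriv_boundary`). This is the classical small-data / large-viscosity
regime of Constantin–Foias 1988 Ch. 9–10 and FMRT 2001 Ch. III, in the tree's vocabulary.

* `enstrophy_production_le` — `−ν‖Δv‖₂² + ∫ ⟪(v·∇)v − f, Δv⟫ ≤ (8K⁴/ν³)(‖∇v‖₂²)³ + ‖f‖₂²/(2ν)`;
* `gradNormSq_le_two_mul_on_unit_window` — the barrier step on `[s, s + 1]`;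
* `gradNormSq_le_of_barrier` / `periodicOrbitsEnstrophyBound_laminar` — the uniform bound for all
  bounded-energy global classical solutions, and the item's conclusion, in the laminar regime.

References: P. Constantin, C. Foias, *Navier–Stokes Equations* (1988), Ch. 9–10; C. Foias,
O. Manley, R. Rosa, R. Temam, *Navier–Stokes Equations and Turbulence* (2001), Ch. II App. A
(A.26b), (A.55), Ch. III §2.
-/

-- `Summit.<Summit>.<Problem>` is the tree's mandated summit-side namespace (CONVENTIONS §2); for this
-- single-conjunct summit the two coincide, so the duplicate is deliberate.
set_option linter.dupNamespace false

noncomputable section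

open scoped BigOperators Topology InnerProductSpace NNReal
open Filter Set Function MeasureTheory

namespace Summit.AnomalousDissipation.AnomalousDissipation.Theorems.HopfSnake.PeriodicOrbitsEnstrophyBound

open Literature.Analysis.FunctionSpaces Literature.Analysis.FunctionSpaces.Torus
open Literature.Analysis.FluidPDE

/-! ### The enstrophy production bound at a fixed time -/

/-- **Enstrophy production bound.** Let `K` be a constant of the dissipation form of the
three-dimensional trilinear estimate (`Torus.abs_integral_inner_convect_laplacian_le_dissipation`:
`|∫ ⟪(v·∇)v, Δv⟫| ≤ (ν/2)‖Δv‖₂² + (8K⁴/ν³)(‖∇v‖₂²)³`). Then for `ν > 0`, smooth `f` and smooth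
divergence-free `v` on `T³` the right-hand side of the enstrophy equation satisfies
`−ν‖Δv‖₂² + ∫ ⟪(v·∇)v − f, Δv⟫ ≤ (8K⁴/ν³)(‖∇v‖₂²)³ + ‖f‖₂²/(2ν)`
(the force paired by Young, `‖f‖‖Δv‖ ≤ ‖f‖²/(2ν) + (ν/2)‖Δv‖²`; FMRT 2001 Ch. III §2,
Constantin–Foias 1988 Ch. 10). [folklore] -/
theorem enstrophy_production_le {K : ℝ≥0}
    (hK : ∀ ν : ℝ, 0 < ν → ∀ v : UnitAddTorus (Fin 3) → EuclideanSpace ℝ (Fin 3), IsSmooth v →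
      IsDivFree v → |∫ x, ⟪convect v v x, laplacian v x⟫_ℝ| ≤
        ν / 2 * (∫ x, ‖laplacian v x‖ ^ 2) + 8 * (K : ℝ) ^ 4 / ν ^ 3 * gradNormSq v ^ 3)
    {ν : ℝ} (hν : 0 < ν) {f v : UnitAddTorus (Fin 3) → EuclideanSpace ℝ (Fin 3)} (hf : IsSmooth f)
    (hv : IsSmooth v) (hdiv : IsDivFree v) :
    -ν * (∫ x, ‖laplacian v x‖ ^ 2) + ∫ x, ⟪convect v v x - f x, laplacian v x⟫_ℝ ≤
      8 * (K : ℝ) ^ 4 / ν ^ 3 * gradNormSq v ^ 3 + (2 * ν)⁻¹ * ∫ x, ‖f x‖ ^ 2 := by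
  set L : ℝ := ∫ x, ‖laplacian v x‖ ^ 2 with hL
  have hΔ : IsSmooth (laplacian v) := hv.laplacian
  have iC : Integrable (fun x => ⟪convect v v x, laplacian v x⟫_ℝ) volume :=
    ((hv.convect hv).inner hΔ).integrable
  have iF : Integrable (fun x => ⟪f x, laplacian v x⟫_ℝ) volume := (hf.inner hΔ).integrable
  have i1 : Integrable (fun x => ‖f x‖ ^ 2) volume :=
    (hf.continuous.norm.pow 2).integrable_unitAddTorus
  have i2 : Integrable (fun x => ‖laplacian v x‖ ^ 2) volume :=
    (hΔ.continuous.norm.pow 2).integrable_unitAddTorus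
  have hsplit : ∫ x, ⟪convect v v x - f x, laplacian v x⟫_ℝ =
      (∫ x, ⟪convect v v x, laplacian v x⟫_ℝ) - ∫ x, ⟪f x, laplacian v x⟫_ℝ := by
    simp_rw [inner_sub_left]
    exact integral_sub iC iF
  have h1 : ∫ x, ⟪convect v v x, laplacian v x⟫_ℝ ≤
      ν / 2 * L + 8 * (K : ℝ) ^ 4 / ν ^ 3 * gradNormSq v ^ 3 :=
    (le_abs_self _).trans (hK ν hν v hv hdiv)
  have h2 : -∫ x, ⟪f x, laplacian v x⟫_ℝ ≤ (2 * ν)⁻¹ * (∫ x, ‖f x‖ ^ 2) + ν / 2 * L := by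
    rw [← integral_neg]
    have key : ∫ x, -⟪f x, laplacian v x⟫_ℝ ≤
        ∫ x, ((2 * ν)⁻¹ * ‖f x‖ ^ 2 + ν / 2 * ‖laplacian v x‖ ^ 2) := by
      refine integral_mono iF.neg ((i1.const_mul _).add (i2.const_mul _)) fun x => ?_
      have e1 : -⟪f x, laplacian v x⟫_ℝ ≤ ‖f x‖ * ‖laplacian v x‖ := by
        have h := real_inner_le_norm (-(f x)) (laplacian v x)
        rwa [inner_neg_left, norm_neg] at h
      have e2 : ‖f x‖ * ‖laplacian v x‖ ≤
          (2 * ν)⁻¹ * ‖f x‖ ^ 2 + ν / 2 * ‖laplacian v x‖ ^ 2 := by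
        have hsq : 0 ≤ (2 * ν)⁻¹ * (‖f x‖ - ν * ‖laplacian v x‖) ^ 2 := by positivity
        have hid : (2 * ν)⁻¹ * (‖f x‖ - ν * ‖laplacian v x‖) ^ 2 =
            (2 * ν)⁻¹ * ‖f x‖ ^ 2 + ν / 2 * ‖laplacian v x‖ ^ 2 - ‖f x‖ * ‖laplacian v x‖ := by
          field_simp
          ring
        linarith
      dsimp only
      linarith
    rw [integral_add (i1.const_mul _) (i2.const_mul _), integral_const_mul, integral_const_mul]
      at key
    exact key
  rw [hsplit]
  linarith

/-! ### The barrier step on a unit window -/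

variable {ν : ℝ} {f : UnitAddTorus (Fin 3) → EuclideanSpace ℝ (Fin 3)}
  {u : ℝ → UnitAddTorus (Fin 3) → EuclideanSpace ℝ (Fin 3)} {p : ℝ → UnitAddTorus (Fin 3) → ℝ}

/-- **Barrier step.** With `K` as in `enstrophy_production_le`, let `(u, p)` be a global classical
solution of `NS_ν(f)` (`ν > 0`, `f` smooth and steady) and let the level `Y` be a strict barrier
over unit time, `128K⁴Y³/ν³ + ‖f‖₂²/ν < Y`. If `‖∇u(s)‖₂² ≤ Y` then `‖∇u(t)‖₂² ≤ 2Y` for all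
`t ∈ [s, s + 1]`: the half-enstrophy `z = ½‖∇u‖₂²` has right derivative
`−ν‖Δu‖₂² + ∫ ⟪(u·∇)u − f, Δu⟫ ≤ (8K⁴/ν³)(2z)³ + ‖f‖₂²/(2ν)` (enstrophy equation
`Torus.IsClassicalNSSolutionOn.hasDerivWithinAt_half_gradNormSq` and `enstrophy_production_le`), which
on the fence `z = Y/2 + (Y/2)(t − s) ≤ Y` is `< Y/2`, the slope of the fence; Mathlib's fencing
theorem `image_le_of_deriv_right_lt_deriv_boundary` concludes. [folklore] -/
theorem gradNormSq_le_two_mul_on_unit_window {K : ℝ≥0}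
    (hK : ∀ ν : ℝ, 0 < ν → ∀ v : UnitAddTorus (Fin 3) → EuclideanSpace ℝ (Fin 3), IsSmooth v →
      IsDivFree v → |∫ x, ⟪convect v v x, laplacian v x⟫_ℝ| ≤
        ν / 2 * (∫ x, ‖laplacian v x‖ ^ 2) + 8 * (K : ℝ) ^ 4 / ν ^ 3 * gradNormSq v ^ 3)
    (hν : 0 < ν) (hf : IsSmooth f) (h : IsClassicalNSSolutionOn univ ν (fun _ => f) u p)
    {Y s : ℝ} (hbar : 128 * (K : ℝ) ^ 4 / ν ^ 3 * Y ^ 3 + (∫ x, ‖f x‖ ^ 2) / ν < Y)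
    (hs : gradNormSq (u s) ≤ Y) :
    ∀ t ∈ Icc s (s + 1), gradNormSq (u t) ≤ 2 * Y := by
  set F : ℝ := ∫ x, ‖f x‖ ^ 2 with hFdef
  have hY0 : 0 ≤ Y := (gradNormSq_nonneg _).trans hs
  set z : ℝ → ℝ := fun t => 2⁻¹ * gradNormSq (u t) with hz
  set D : ℝ → ℝ := fun t => -ν * (∫ x, ‖laplacian (u t) x‖ ^ 2) +
    ∫ x, ⟪convect (u t) (u t) x - f x, laplacian (u t) x⟫_ℝ with hD
  set B : ℝ → ℝ := fun t => Y / 2 + Y / 2 * (t - s) with hB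
  have hu := h.smooth_velocity
  have hcont : ContinuousOn z (Icc s (s + 1)) :=
    continuousOn_const.mul
      ((hu.continuousOn_gradNormSq convex_univ uniqueDiffOn_univ).mono (subset_univ _))
  have hderiv : ∀ x ∈ Ico s (s + 1), HasDerivWithinAt z (D x) (Ici x) x := by
    intro x _
    have hx1 : x < x + 1 := by linarith
    have hsol := h.mono (subset_univ (Icc x (x + 1))) (uniqueDiffOn_Icc hx1)
    have hd := hsol.hasDerivWithinAt_half_gradNormSq hx1 (left_mem_Icc.2 hx1.le)
    rw [← Ici_inter_Iic] at hd
    exact (hasDerivWithinAt_inter (Iic_mem_nhds hx1)).1 hd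
  have hBderiv : ∀ x, HasDerivAt B (Y / 2) x := fun x =>
    ((((hasDerivAt_id x).sub_const s).const_mul (Y / 2)).const_add (Y / 2)).congr_deriv
      (mul_one _)
  have hzs : z s ≤ B s := by
    simp only [hz, hB, sub_self, mul_zero, add_zero]
    linarith
  have hbound : ∀ x ∈ Ico s (s + 1), z x = B x → D x < Y / 2 := by
    intro x hx hzB
    have hBx : B x ≤ Y := by
      simp only [hB]
      nlinarith [hx.1, hx.2, hY0]
    have hxY : gradNormSq (u x) ≤ 2 * Y := by
      have hzx : z x ≤ Y := hzB.le.trans hBx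
      simp only [hz] at hzx
      linarith
    have hprod := enstrophy_production_le hK hν hf (hu.isSmooth_slice (mem_univ x))
      (h.divFree x (mem_univ x))
    have hy0 : 0 ≤ gradNormSq (u x) := gradNormSq_nonneg _
    have hpow : gradNormSq (u x) ^ 3 ≤ (2 * Y) ^ 3 := pow_le_pow_left₀ hy0 hxY 3
    have hcoef : 0 ≤ 8 * (K : ℝ) ^ 4 / ν ^ 3 := by positivity
    have hFν : (2 * ν)⁻¹ * F = F / ν / 2 := by
      field_simp
    calc D x ≤ 8 * (K : ℝ) ^ 4 / ν ^ 3 * gradNormSq (u x) ^ 3 + (2 * ν)⁻¹ * F := hprod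
      _ ≤ 8 * (K : ℝ) ^ 4 / ν ^ 3 * (2 * Y) ^ 3 + (2 * ν)⁻¹ * F := by gcongr
      _ = 2⁻¹ * (128 * (K : ℝ) ^ 4 / ν ^ 3 * Y ^ 3 + F / ν) := by
          rw [hFν]
          ring
      _ < Y / 2 := by linarith
  intro t ht
  have hzt := image_le_of_deriv_right_lt_deriv_boundary hcont hderiv hzs hBderiv hbound ht
  have hBt : B t ≤ Y := by
    simp only [hB]
    nlinarith [ht.1, ht.2, hY0]
  have : z t ≤ Y := hzt.trans hBt
  simp only [hz] at this
  linarith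

/-! ### The uniform bound in the laminar regime -/

/-- **Uniform enstrophy bound behind a barrier.** With `K` as in `enstrophy_production_le`: for a
global classical solution of `NS_ν(f)` (`ν > 0`, `f` smooth and steady) with kinetic energy `≤ R`
at all times, every level `Y` above the good level `(2R + ½‖f‖₂²)/ν` of `exists_gradNormSq_le`
that is a strict barrier over unit time (`128K⁴Y³/ν³ + ‖f‖₂²/ν < Y`) bounds the enstrophy for
ALL times: `‖∇u(t)‖₂² ≤ 2Y` (every `t` lies within one time unit after a good instant
`s ∈ [t − 1, t]`, and `gradNormSq_le_two_mul_on_unit_window` fences `[s, s + 1]`). No periodicity,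
mean-zero or divergence-free condition on `f` is used. [folklore] -/
theorem gradNormSq_le_of_barrier {K : ℝ≥0}
    (hK : ∀ ν : ℝ, 0 < ν → ∀ v : UnitAddTorus (Fin 3) → EuclideanSpace ℝ (Fin 3), IsSmooth v →
      IsDivFree v → |∫ x, ⟪convect v v x, laplacian v x⟫_ℝ| ≤
        ν / 2 * (∫ x, ‖laplacian v x‖ ^ 2) + 8 * (K : ℝ) ^ 4 / ν ^ 3 * gradNormSq v ^ 3)
    (hν : 0 < ν) (hf : IsSmooth f) (h : IsClassicalNSSolutionOn univ ν (fun _ => f) u p) {R : ℝ}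
    (hE : ∀ t, kineticEnergy (u t) ≤ R) {Y : ℝ} (hGY : (2 * R + 2⁻¹ * ∫ x, ‖f x‖ ^ 2) / ν ≤ Y)
    (hbar : 128 * (K : ℝ) ^ 4 / ν ^ 3 * Y ^ 3 + (∫ x, ‖f x‖ ^ 2) / ν < Y) (t : ℝ) :
    gradNormSq (u t) ≤ 2 * Y := by
  obtain ⟨s, hs, hsG⟩ := exists_gradNormSq_le hν hf h hE (t - 1)
  exact gradNormSq_le_two_mul_on_unit_window hK hν hf h hbar (hsG.trans hGY) t
    ⟨by linarith [hs.2], by linarith [hs.1]⟩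

/-- **The laminar regime, barrier form.** There is a universal constant `K ≥ 0` (that of the
three-dimensional trilinear estimate `Torus.abs_integral_inner_convect_laplacian_le_dissipation`)
such that for every `ν > 0`, smooth steady `f`, energy level `R` and level `Y` with
`(2R + ½‖f‖₂²)/ν ≤ Y` and `128K⁴Y³/ν³ + ‖f‖₂²/ν < Y`, EVERY global classical solution of
`NS_ν(f)` with kinetic energy `≤ R` at all times has `‖∇u(t)‖₂² ≤ 2Y` for all `t`. Such a level
exists as soon as `R + ‖f‖₂² ≲ ν^{5/2}` (see `periodicOrbitsEnstrophyBound_smallData`), the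
small-Grashof / large-viscosity regime of Constantin–Foias 1988 Ch. 9–10, FMRT 2001 Ch. III.
[folklore] -/
theorem gradNormSq_le_laminar :
    ∃ K : ℝ≥0, ∀ ν : ℝ, 0 < ν → ∀ f : UnitAddTorus (Fin 3) → EuclideanSpace ℝ (Fin 3), IsSmooth f →
      ∀ R Y : ℝ, (2 * R + 2⁻¹ * ∫ x, ‖f x‖ ^ 2) / ν ≤ Y →
        128 * (K : ℝ) ^ 4 / ν ^ 3 * Y ^ 3 + (∫ x, ‖f x‖ ^ 2) / ν < Y →
          ∀ (u : ℝ → UnitAddTorus (Fin 3) → EuclideanSpace ℝ (Fin 3))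
            (p : ℝ → UnitAddTorus (Fin 3) → ℝ),
            IsClassicalNSSolutionOn univ ν (fun _ => f) u p → (∀ t, kineticEnergy (u t) ≤ R) →
              ∀ t, gradNormSq (u t) ≤ 2 * Y := by
  obtain ⟨K, hK⟩ :=
    abs_integral_inner_convect_laplacian_le_dissipation (d := Fin 3) (Fintype.card_fin 3)
  exact ⟨K, fun ν hν f hf R Y hGY hbar u p h hE t =>
    gradNormSq_le_of_barrier hK hν hf h hE hGY hbar t⟩

/-- **The laminar regime, small-data form.** There is a universal `K > 0` such that for all
`ν > 0`, smooth steady `f` and `R` with `64 K² (R + ‖f‖₂²) ≤ ν^{5/2}`, every global classical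
solution of `NS_ν(f)` on `ℝ × T³` with kinetic energy `≤ R` at all times satisfies, for all `t`,
`‖∇u(t)‖₂² ≤ 4(R + ‖f‖₂²)/ν + ν^{3/2}/(16K²)`: the level `Y = (2R + 2‖f‖₂²)/ν + ν^{3/2}/(32K²)`
is then a strict barrier for `gradNormSq_le_laminar` (with the tree's trilinear constant enlarged
by `1` to make it positive). [folklore] -/
theorem periodicOrbitsEnstrophyBound_smallData :
    ∃ K : ℝ, 0 < K ∧ ∀ ν : ℝ, 0 < ν → ∀ f : UnitAddTorus (Fin 3) → EuclideanSpace ℝ (Fin 3),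
      IsSmooth f → ∀ R : ℝ, 64 * K ^ 2 * (R + ∫ x, ‖f x‖ ^ 2) ≤ ν ^ 2 * Real.sqrt ν →
        ∀ (u : ℝ → UnitAddTorus (Fin 3) → EuclideanSpace ℝ (Fin 3))
          (p : ℝ → UnitAddTorus (Fin 3) → ℝ),
          IsClassicalNSSolutionOn univ ν (fun _ => f) u p → (∀ t, kineticEnergy (u t) ≤ R) →
            ∀ t, gradNormSq (u t) ≤
              4 * (R + ∫ x, ‖f x‖ ^ 2) / ν + ν * Real.sqrt ν / (16 * K ^ 2) := by
  obtain ⟨K₀, hK₀⟩ :=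
    abs_integral_inner_convect_laplacian_le_dissipation (d := Fin 3) (Fintype.card_fin 3)
  -- enlarge the constant by one so that it is positive
  set K : ℝ := (K₀ : ℝ) + 1 with hKdef
  have hK0' : (0 : ℝ) ≤ K₀ := K₀.coe_nonneg
  have hKpos : 0 < K := by rw [hKdef]; linarith
  have hK : ∀ ν : ℝ, 0 < ν → ∀ v : UnitAddTorus (Fin 3) → EuclideanSpace ℝ (Fin 3), IsSmooth v →
      IsDivFree v → |∫ x, ⟪convect v v x, laplacian v x⟫_ℝ| ≤
        ν / 2 * (∫ x, ‖laplacian v x‖ ^ 2) + 8 * ((K₀ + 1 : ℝ≥0) : ℝ) ^ 4 / ν ^ 3 * gradNormSq v ^ 3 := by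
    intro ν hν v hv hdiv
    refine (hK₀ ν hν v hv hdiv).trans ?_
    have hy : 0 ≤ gradNormSq v ^ 3 := pow_nonneg (gradNormSq_nonneg v) 3
    have hpow : (K₀ : ℝ) ^ 4 ≤ ((K₀ + 1 : ℝ≥0) : ℝ) ^ 4 := by
      push_cast
      exact pow_le_pow_left₀ hK0' (by linarith) 4
    have hν3 : 0 < ν ^ 3 := pow_pos hν 3
    gcongr
  refine ⟨K, hKpos, fun ν hν f hf R hsmall u p h hE t => ?_⟩
  set F : ℝ := ∫ x, ‖f x‖ ^ 2 with hFdef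
  have hF0 : 0 ≤ F := integral_nonneg fun x => sq_nonneg _
  have hR0 : 0 ≤ R := (Torus.kineticEnergy_nonneg _).trans (hE 0)
  set σ : ℝ := Real.sqrt ν with hσ
  have hσ0 : 0 < σ := Real.sqrt_pos.2 hν
  have hσ2 : σ ^ 2 = ν := Real.sq_sqrt hν.le
  set D : ℝ := (2 * R + 2 * F) / ν with hDdef
  set η : ℝ := ν * σ / (32 * K ^ 2) with hηdef
  set Y : ℝ := D + η with hYdef
  have hD0 : 0 ≤ D := by positivity
  have hη0 : 0 < η := by positivity
  have hY0 : 0 ≤ Y := by positivity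
  have hK2 : 0 < K ^ 2 := by positivity
  -- the smallness hypothesis: `32 K² D ≤ ν σ`
  have h1 : 32 * K ^ 2 * D ≤ ν * σ := by
    rw [hDdef, mul_div_assoc', div_le_iff₀ hν]
    nlinarith [hsmall]
  have h2 : 1024 * K ^ 4 * D ^ 2 ≤ ν ^ 3 := by
    have h := pow_le_pow_left₀ (by positivity : 0 ≤ 32 * K ^ 2 * D) h1 2
    nlinarith [h, hσ2]
  have h3 : 1024 * K ^ 4 * η ^ 2 = ν ^ 3 := by
    rw [hηdef]
    field_simp
    rw [hσ2]
    ring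
  have hY2 : Y ^ 2 ≤ 2 * D ^ 2 + 2 * η ^ 2 := by
    rw [hYdef]
    nlinarith [sq_nonneg (D - η)]
  have h4 : 256 * K ^ 4 * Y ^ 2 ≤ ν ^ 3 := by
    have h := mul_le_mul_of_nonneg_left hY2 (by positivity : (0 : ℝ) ≤ 256 * K ^ 4)
    nlinarith [h, h2, h3]
  have h5 : 128 * K ^ 4 / ν ^ 3 * Y ^ 3 ≤ Y / 2 := by
    have hν3 : 0 < ν ^ 3 := pow_pos hν 3
    rw [div_mul_eq_mul_div, div_le_iff₀ hν3]
    have h := mul_le_mul_of_nonneg_right h4 hY0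
    nlinarith [h]
  have h6 : F / ν < Y / 2 := by
    have hD2 : D / 2 = (R + F) / ν := by
      rw [hDdef]
      ring
    have hFD : F / ν ≤ (R + F) / ν := div_le_div_of_nonneg_right (by linarith) hν.le
    linarith
  have hbar : 128 * ((K₀ + 1 : ℝ≥0) : ℝ) ^ 4 / ν ^ 3 * Y ^ 3 + F / ν < Y := by
    have hc : ((K₀ + 1 : ℝ≥0) : ℝ) = K := by rw [hKdef]; push_cast; ring
    rw [hc]
    linarith
  have hGY : (2 * R + 2⁻¹ * F) / ν ≤ Y := by
    have : (2 * R + 2⁻¹ * F) / ν ≤ D := by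
      rw [hDdef]
      exact div_le_div_of_nonneg_right (by linarith) hν.le
    linarith
  have hmain := gradNormSq_le_of_barrier hK hν hf h hE hGY hbar t
  have h2Y : 2 * Y = 4 * (R + F) / ν + ν * σ / (16 * K ^ 2) := by
    rw [hYdef, hDdef, hηdef]
    field_simp
    ring
  linarith

/-- **`PeriodicOrbitsEnstrophyBound` in the laminar regime.** The item's matrix, verbatim, under
the extra premise `64 K² (R + ‖f‖₂²) ≤ ν^{5/2}` on the data (with the universal `K > 0` of
`periodicOrbitsEnstrophyBound_smallData`): for such `ν`, `f`, `R` there is `C` with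
`‖∇u(t)‖₂² ≤ C` for all `t` and all mean-zero time-periodic classical solutions of `NS_ν(f)` with
kinetic energy `≤ R` (indeed for all global classical solutions with energy `≤ R`). Outside this
regime the item is the open uniform-`H¹` (quantitative regularity) problem, see
`periodicOrbitsEnstrophyBound_of_uniform_propagation`. [folklore] -/
theorem periodicOrbitsEnstrophyBound_laminar :
    ∃ K : ℝ, 0 < K ∧ ∀ ν : ℝ, 0 < ν → ∀ f : UnitAddTorus (Fin 3) → EuclideanSpace ℝ (Fin 3),
      IsSmooth f → IsDivFree f → HasZeroMean f → ∀ R : ℝ,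
        64 * K ^ 2 * (R + ∫ x, ‖f x‖ ^ 2) ≤ ν ^ 2 * Real.sqrt ν → ∃ C : ℝ,
          ∀ (u : ℝ → UnitAddTorus (Fin 3) → EuclideanSpace ℝ (Fin 3))
            (p : ℝ → UnitAddTorus (Fin 3) → ℝ) (T : ℝ),
            IsClassicalNSSolutionOn Set.univ ν (fun _ => f) u p → (∀ t, HasZeroMean (u t)) →
              0 < T → Function.Periodic u T → (∀ t, kineticEnergy (u t) ≤ R) →
                ∀ t, gradNormSq (u t) ≤ C := by
  obtain ⟨K, hKpos, hK⟩ := periodicOrbitsEnstrophyBound_smallData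
  exact ⟨K, hKpos, fun ν hν f hf _ _ R hsmall =>
    ⟨4 * (R + ∫ x, ‖f x‖ ^ 2) / ν + ν * Real.sqrt ν / (16 * K ^ 2),
      fun u p _ h _ _ _ hE t => hK ν hν f hf R hsmall u p h hE t⟩⟩

end Summit.AnomalousDissipation.AnomalousDissipation.Theorems.HopfSnake.PeriodicOrbitsEnstrophyBound

end
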